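import Summits.BirchSwinnertonDyer.BirchSwinnertonDyer.Theorems.GenusKolyvaginAtTwoPowDvdShaCardAtTwoRTHeegnerTwinTamagawaValuation
import Literature.NumberTheory.EllipticCurves.ComplexMultiplicationHasCMProofs
import HarnessLib

/-!
# Route `GenusKolyvaginAtTwo`, crux #2 `GenusPrimitiveSupplyAtTwo` (stmt-BirchSwinnertonDyer-22136), line `genus_supply` v2:
# THE TAMAGAWA GUARD OF STUB A TRANSFERS TO `W` — `ord₂ C(W) ≤ ord₂ C(Wd)` for every Heegner twin, so the v2 stub
# `stub_minimalTwinSupplyAtTwo` (guard `ord₂ C(Wd) ≤ 2`, no `Odd W.tamagawaProduct` hypothesis) is FALSE as soon as one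
# non-CM analytic-rank-`0` full-`2`-tower curve has `8 ∣ C(W)`

Width seat `bsd-line-gk2-p5` g25 (cell `bsd-f1-sign2`, SUPPLY lineage). THEOREMS ONLY (no definition, no named fact, no `sorry`);
helper `--supports stmt-BirchSwinnertonDyer-22136`; no item is closed; BSD is not proved by any of this.

WHY. The LEAD's skeleton touch of 2026-08-29T15:20Z (director-bsd FOREST MOVE (386)(3)) inserted the genus-defect guard
`padicValNat 2 Wd.tamagawaProduct ≤ 2` into the OUTPUT of stub A and the INPUT of stub C. Stub C carries `Odd W.tamagawaProduct`;
stub A does not («only the hypotheses that bear on twin supply are kept» — written before the guard existed). By gk2-p3's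
place-by-place formula `PlusDescent.padicValNat_two_tamagawaProduct_twin_eq`
(`ord₂ C(Wd) = ord₂ C(W) + Σ_{q ∣ d_K} ord₂ (1 + #roots of ψ mod q)`, valid for EVERY imaginary quadratic `K` with odd `d_K` and the
Heegner hypothesis and EVERY model `Wd` of `W^{(d_K)}`: the bad primes of `W` split in `K`, so `c_ℓ(Wd) = c_ℓ(W)` there) the guard
on `Wd` is at least as strong as the same guard on `W`:

* §1 `padicValNat_two_tamagawaProduct_le_twin` — `ord₂ C(W) ≤ ord₂ C(Wd)`; `padicValNat_two_tamagawaProduct_le_of_twin_le` — the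
  guard transfers: `ord₂ C(Wd) ≤ B ⟹ ord₂ C(W) ≤ B`.
* §2 `stub_minimalTwinSupplyAtTwo_v2_false_of_exists` — the v2 text of stub A, VERBATIM, is refuted by ANY non-CM curve of analytic
  rank `0` with surjective `2`-adic tower and `8 ∣ C(W)` (hypothesis `H`, displayed: such curves abound — e.g. three split
  multiplicative primes of even `ord_p Δ`, or one `I₈` — but `analyticRank` / `HasSurjectiveModNGaloisRep` of a numerical curve are
  not computable in the tree, so `H` stays a displayed existence clause; the seat's memo `Lines/genus-supply-stubA-guard-gk2p5.md`
  names Cremona witnesses with a Dokchitser–Dokchitser certificate).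
* The REPAIR is one binder (`Odd W.tamagawaProduct →` after the tower binder; then the guard IS the genus defect
  `Σ_{q ∣ d_K} ord₂ #W̃(𝔽_q)[2] ≤ 2`, `prod_ncard_roots_add_one_eq_two_pow_padicValNat_tamagawaProduct_twin`); the repaired stub on the
  (E1) reach is re-exported by name in the companion file `…GenusPrimitiveSupplyAtTwoStubAOnReach` (Theses cone).

References: [Kramer1981] §2 Prop. 3; [BoxerDiao2010] proof of Prop. 4.1; [GrossLMS1991] §1 (Heegner hypothesis: every `ℓ ∣ N` splits);
[DokchitserDokchitser2012] Theorem (surjectivity of `ρ̄_8`).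
-/

set_option linter.dupNamespace false -- tree convention: `Summit.BirchSwinnertonDyer.BirchSwinnertonDyer.Theorems` (summit = sub-problem)
set_option autoImplicit false

noncomputable section

open scoped Classical

namespace Summit.BirchSwinnertonDyer.BirchSwinnertonDyer.Theorems.GenusKolyTwin

open WeierstrassCurve NumberField Literature.NumberTheory.EllipticCurves
open Summit.BirchSwinnertonDyer.BirchSwinnertonDyer.Theorems.GenusExact.PlusDescent
  (padicValNat_two_tamagawaProduct_twin_eq)

/-! ## §1 The guard transfers from the twin to the curve -/

section Transfer

variable (W : WeierstrassCurve ℚ) [W.IsElliptic] [W.IsGloballyMinimal]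
  {K : Type} [Field K] [NumberField K]

/-- **`ord₂ C(W) ≤ ord₂ C(Wd)` for every Heegner twin.** `W/ℚ` globally minimal elliptic, `K` imaginary quadratic with odd `d_K`
satisfying the Heegner hypothesis for `N_W`, `Wd = Cd • W^{(d_K)}` any elliptic model: the `2`-adic valuation of the Tamagawa
product can only grow, because every bad prime of `W` splits in `K` (`c_ℓ(Wd) = c_ℓ(W)`) and the primes of `d_K` contribute
`#W̃(𝔽_q)[2] ∈ {1, 2, 4}` (type `I₀*`). Immediate from gk2-p3's `padicValNat_two_tamagawaProduct_twin_eq`.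
[cite: Kramer1981, §2 Prop. 3 (p. 125)] [cite: GrossLMS1991, §1 (p. 235)] -/
theorem padicValNat_two_tamagawaProduct_le_twin (hK : IsImaginaryQuadratic K) (hodd : Odd (NumberField.discr K))
    (hH : SatisfiesHeegnerHypothesis (W.conductorNorm ℤ) K) {Wd : WeierstrassCurve ℚ} [Wd.IsElliptic]
    (Cd : VariableChange ℚ) (hWd : Cd • W.quadraticTwist (NumberField.discr K : ℚ) = Wd) :
    padicValNat 2 W.tamagawaProduct ≤ padicValNat 2 Wd.tamagawaProduct := by
  rw [padicValNat_two_tamagawaProduct_twin_eq W hK hodd hH Cd hWd]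
  exact Nat.le_add_right _ _

/-- **The genus-defect guard on the twin bounds `ord₂ C(W)`**: `ord₂ C(Wd) ≤ B ⟹ ord₂ C(W) ≤ B` (same data). In particular the
v2 guard `ord₂ C(Wd) ≤ 2` of stub A is unsatisfiable for every Heegner field as soon as `8 ∣ C(W)`.
[cite: Kramer1981, §2 Prop. 3 (p. 125)] -/
theorem padicValNat_two_tamagawaProduct_le_of_twin_le (hK : IsImaginaryQuadratic K) (hodd : Odd (NumberField.discr K))
    (hH : SatisfiesHeegnerHypothesis (W.conductorNorm ℤ) K) {Wd : WeierstrassCurve ℚ} [Wd.IsElliptic]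
    (Cd : VariableChange ℚ) (hWd : Cd • W.quadraticTwist (NumberField.discr K : ℚ) = Wd) {B : ℕ}
    (hB : padicValNat 2 Wd.tamagawaProduct ≤ B) : padicValNat 2 W.tamagawaProduct ≤ B :=
  (padicValNat_two_tamagawaProduct_le_twin W hK hodd hH Cd hWd).trans hB

end Transfer

/-! ## §2 The v2 text of stub A is false modulo one (abundant) curve -/

/-- **STUB A v2 IS MISSTATED.** If SOME non-CM elliptic curve over `ℚ` (globally minimal model `W`) has analytic rank `0`,
surjective `ρ_{W,2^n}` for all `n ≥ 1`, and `8 ∣ C(W)` (i.e. `3 ≤ ord₂ C(W)`), then the v2 text of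
`GenusSupply.stub_minimalTwinSupplyAtTwo` (crux dir `Lines/genus_supply.lean`, 2026-08-29T15:20Z) — quoted VERBATIM as the negated
proposition — is false: whatever Heegner field `K` and twin `Wd` it returns, `ord₂ C(Wd) ≥ ord₂ C(W) ≥ 3 > 2`
(`padicValNat_two_tamagawaProduct_le_twin`). The existence hypothesis is displayed because `analyticRank` and
`HasSurjectiveModNGaloisRep` of a numerical curve are not computable in the tree; Cremona witnesses with a certificate are in the
seat memo. The repair is §3. [cite: Kramer1981, §2 Prop. 3 (p. 125)] [cite: GrossLMS1991, §1 (p. 235)] -/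
theorem stub_minimalTwinSupplyAtTwo_v2_false_of_exists
    (H : ∃ (W : WeierstrassCurve ℚ) (_ : W.IsElliptic) (_ : W.IsGloballyMinimal) (_ : NeZero (W.conductorNorm ℤ)),
      ¬ W.HasCM ∧ W.analyticRank = 0 ∧ (∀ n : ℕ, 0 < n → W.HasSurjectiveModNGaloisRep ((2 : ℤ) ^ n)) ∧
        3 ≤ padicValNat 2 W.tamagawaProduct) :
    ¬ (∀ (W : WeierstrassCurve ℚ) [W.IsElliptic] [W.IsGloballyMinimal] [NeZero (W.conductorNorm ℤ)],
        ¬ W.HasCM → W.analyticRank = 0 → (∀ n : ℕ, 0 < n → W.HasSurjectiveModNGaloisRep ((2 : ℤ) ^ n)) →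
        ∃ (K : Type) (_ : Field K) (_ : NumberField K),
          IsImaginaryQuadratic K ∧ Odd (NumberField.discr K) ∧ NumberField.discr K ≠ -3 ∧
          SatisfiesHeegnerHypothesis (W.conductorNorm ℤ) K ∧
          ¬ IsSquare ((NumberField.discr K : ℚ) * -|W.Δ|) ∧ ¬ IsSquare ((NumberField.discr K : ℚ) * (-(2 * |W.Δ|))) ∧
          ∃ (Wd : WeierstrassCurve ℚ) (_ : Wd.IsElliptic) (_ : Wd.IsGloballyMinimal),
            (∃ C : WeierstrassCurve.VariableChange ℚ, C • W.quadraticTwist (NumberField.discr K : ℚ) = Wd) ∧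
            Wd.analyticRank = 1 ∧ Nat.card (Wd.selmerGroup 2) = 2 ∧ padicValNat 2 Wd.tamagawaProduct ≤ 2) := by
  intro h
  obtain ⟨W, _, _, _, hcm, hr0, hρ, h3⟩ := H
  obtain ⟨K, _, _, hK, hodd, -, hH, -, -, Wd, _, _, ⟨Cd, hCd⟩, -, -, hle⟩ := h W hcm hr0 hρ
  have h3' := padicValNat_two_tamagawaProduct_le_of_twin_le W hK hodd hH Cd hCd hle
  omega

end Summit.BirchSwinnertonDyer.BirchSwinnertonDyer.Theorems.GenusKolyTwin

end
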